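import Literature.Computability.FineGrained.APSPPowerDriver
import HarnessLib

/-!
# APSP `≤₃` distance product (VW–W 2018, §2.1 p. 27:8): the verified reduction

The discharge of the named fact `APSP_fgReducible_minPlusProduct` of
`Literature.Computability.FineGrained.SubcubicEquivalencesAPSP`: for every weight exponent `c`,
APSP on `n`-vertex digraphs with weights in `[-nᶜ, nᶜ]` (no negative cycle) is subcubically
reducible, in the exact sense of `FGReducible` (VVW ICM 2018, Def. 2.1), to the distance product
of `n × n` matrices with entries in `[-n^{c+1}, n^{c+1}] ∪ {∞}` — Vassilevska Williams–Williams,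
J. ACM 65 (2018), §2.1 p. 27:8 ("the distance product can be used to solve APSP in arbitrary
weighted graphs [28]", [28] = Fischer–Meyer 1971), by repeated squaring (CLRS §25.1).

* `psMP`: the product step of the square-and-multiply driver
  (`Literature.Computability.FineGrained.APSPPowerDriver`) that hands the two adjacent operand
  blocks `[n, ⌜X⌝, n, ⌜Y⌝]` — literally the encoding of the distance-product instance `(X, Y)`
  (`readSeg_operands`) — to the oracle and copies the answer `⌜X ⋆ Y⌝` back (`psMP_spec`: it meets
  the contract `ProdSpec c (MinPlusProduct (c + 1)) psMP (c + 5) …` with workspace `n² + 2`, time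
  `6 n² + 10`, one query of size `n` and length `2 n² + 2` per call);
* the budgets (`psMP_budget`): with `≤ 2 · size n = O(log n)` calls, time `O(n² log n)`, oracle
  ledger `O(log n · (n³)^{1-ε})`, query length `O(n² log n)`, all `≤ C (n³)^{1-δ} + C` for
  `δ = min (ε/2) (1/6)` (`size_le_rpow`: `size n = O(n^η)` for every `η > 0`);
* **`APSP_fgReducible_minPlusProduct_holds`** (`c' = c + 1`).

## References

* V. Vassilevska Williams, R. R. Williams, *Subcubic equivalences between path, matrix, and
  triangle problems*, J. ACM 65 (2018), Art. 27, §2.1 p. 27:8; §4 p. 27:13. doi:10.1145/3186893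
* M. J. Fischer, A. R. Meyer, *Boolean matrix multiplication and transitive closure*, 12th SWAT
  (1971), 129–131 (VW–W ref. [28]).
* T. H. Cormen, C. E. Leiserson, R. L. Rivest, C. Stein, *Introduction to Algorithms*, 3rd ed.,
  §25.1.
* V. Vassilevska Williams, *On some fine-grained questions in algorithms and complexity*,
  Proc. ICM 2018, §2, Def. 2.1.
-/


namespace Literature.Computability.FineGrained.APSPPower

open Cryptography Cryptography.WordRAM Cryptography.WordRAM.SProg Matrix

/-! ## The product step through a distance-product oracle -/

/-- The product step of the reduction APSP `≤₃` distance product: compute the query length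
`2 n² + 2`, hand the two adjacent operand blocks `[n, ⌜X⌝, n, ⌜Y⌝]` to the oracle (answer at the
free pointer `F`), copy the `n²` codes of the answer `⌜X ⋆ Y⌝` over those of `X`, and advance the
free pointer past the answer. [folklore] -/
def psMP : SProg :=
  seqs [block [(.mul, .dir 20, .dir 2, .dir 2), (.add, .dir 21, .dir 20, .dir 20),
      (.add, .dir 21, .dir 21, .imm 2)],
    query (.dir 16) (.dir 21) (.dir 9),
    block [(.add, .dir 12, .dir 20, .imm 0), (.add, .dir 13, .dir 9, .imm 2),
      (.add, .dir 14, .dir 16, .imm 1)],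
    copyUp,
    block [(.add, .dir 9, .dir 9, .dir 20), (.add, .dir 9, .dir 9, .imm 2)]]

section psMP

variable {n : ℕ}

/-- The two adjacent operand blocks read as one segment are the encoding of the distance-product
instance `(X, Y)`. [folklore] -/
theorem readSeg_operands {H : ℕ → ℕ} {pX : ℕ} {X Y : Matrix (Fin n) (Fin n) (WithTop ℤ)}
    (hhX : H pX = n) (hhY : H (pX + n * n + 1) = n) (hX : MatAt H pX X)
    (hY : MatAt H (pX + n * n + 1) Y) :
    readSeg H pX (2 * (n * n) + 2) = encodeMatrixWithTop X ++ encodeMatrixWithTop Y := by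
  have hlen : (encodeMatrixWithTop X ++ encodeMatrixWithTop Y).length = 2 * (n * n) + 2 := by
    simp [encodeMatrixWithTop_length, sq]; ring
  refine readSeg_eq_of_forall hlen fun j hj => ?_
  have hlX : (encodeMatrixWithTop X).length = n * n + 1 := by simp [encodeMatrixWithTop_length, sq]
  have hlY : (encodeMatrixWithTop Y).length = n * n + 1 := by simp [encodeMatrixWithTop_length, sq]
  by_cases hjX : j < n * n + 1
  · rw [List.getElem_append_left (by rw [hlX]; exact hjX)]
    rcases j with _ | t
    · rw [Nat.add_zero, hhX, NegTriToAPSP.getElem_encodeMatrixWithTop_zero]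
    · have ht : t < n * n := by omega
      have hn : 0 < n := Nat.pos_of_ne_zero fun h0 => by subst h0; simp at ht
      rw [NegTriToAPSP.getElem_encodeMatrixWithTop_succ _ t ht,
        show pX + (t + 1) = pX + 1 + (t / n * n + t % n) by rw [Nat.div_add_mod']; omega]
      exact hX ⟨t / n, Nat.div_lt_of_lt_mul (by rwa [Nat.mul_comm] at ht)⟩ ⟨t % n, Nat.mod_lt _ hn⟩
  · rw [List.getElem_append_right (by rw [hlX]; omega)]
    simp only [hlX]
    by_cases hj0 : j = n * n + 1
    · subst hj0
      simp only [Nat.sub_self]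
      rw [show pX + (n * n + 1) = pX + n * n + 1 by omega, hhY,
        NegTriToAPSP.getElem_encodeMatrixWithTop_zero]
    · obtain ⟨t, rfl⟩ : ∃ t, j = n * n + 1 + (t + 1) := ⟨j - (n * n + 1) - 1, by omega⟩
      have ht : t < n * n := by omega
      have hn : 0 < n := Nat.pos_of_ne_zero fun h0 => by subst h0; simp at ht
      simp only [show n * n + 1 + (t + 1) - (n * n + 1) = t + 1 by omega]
      rw [NegTriToAPSP.getElem_encodeMatrixWithTop_succ _ t ht,
        show pX + (n * n + 1 + (t + 1)) = pX + n * n + 1 + 1 + (t / n * n + t % n) by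
          rw [Nat.div_add_mod']; omega]
      exact hY ⟨t / n, Nat.div_lt_of_lt_mul (by rwa [Nat.mul_comm] at ht)⟩ ⟨t % n, Nat.mod_lt _ hn⟩

/-- The words of the encoding of an `n^{c+1}`-bounded product are below `(n + 2)^{c+5}`. [folklore] -/
theorem encode_lt_of_bounded {c : ℕ} {Z : Matrix (Fin n) (Fin n) (WithTop ℤ)}
    (hZ : HasBoundedWeights Z (n ^ (c + 1))) {v : ℕ} (hv : v ∈ encodeMatrixWithTop Z) :
    v < (n + 2) ^ (c + 5) := by
  have h := forall_mem_encodeMatrixWithTop_le hZ v hv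
  have h1 : 2 * n ^ (c + 1) + 2 ≤ (n + 2) ^ (c + 5) := code_bound_le (by omega)
  have h2 : n + 2 ≤ (n + 2) ^ (c + 5) :=
    calc n + 2 = (n + 2) ^ 1 := (pow_one _).symm
      _ ≤ (n + 2) ^ (c + 5) := Nat.pow_le_pow_right (by omega) (by omega)
  rcases le_max_iff.1 h with h | h <;> omega

-- The symbolic execution below uses one uniform `simp only` read-normaliser per instruction;
-- not every lemma of the set fires at every instruction.
set_option linter.unusedSimpArgs false in
/-- **The distance-product oracle step meets the contract** with `E = c + 5`, workspace
`n² + 2`, time `6 n² + 10`, one query of size `n` and length `2 n² + 2` per call. [folklore] -/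
theorem psMP_spec (c : ℕ) : ProdSpec c (MinPlusProduct (c + 1)) psMP (c + 5)
    (fun n => n * n + 2) (fun n => 6 * (n * n) + 10) (fun _ => 1) (fun n => n) (fun n => 2 * (n * n) + 2) := by
  intro n w O S H qs X Y hO hn hEw hFw h2 h16 h17 h17F hhX hhY hX hY hbX hbY hbXY hz
  beta_reduce at hFw ⊢
  -- the instance handed to the oracle and its answer
  let y : (MinPlusProduct (c + 1)).Inst := ⟨⟨n, (X, Y)⟩, ⟨hbX, hbY⟩⟩
  have hency : (MinPlusProduct (c + 1)).encode y = encodeMatrixWithTop X ++ encodeMatrixWithTop Y := rfl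
  have hans : O (encodeMatrixWithTop X ++ encodeMatrixWithTop Y) =
      encodeMatrixWithTop (minPlusProduct X Y) := by
    have := hO y
    rw [hency] at this
    simpa [MinPlusProduct, FGProblem.restrict, FGProblem.ofFun] using this
  set eZ := encodeMatrixWithTop (minPlusProduct X Y) with heZ
  have heZlen : eZ.length = n * n + 1 := by simp [heZ, encodeMatrixWithTop_length, sq]
  have heZw : ∀ v ∈ eZ, v < 2 ^ w := fun v hv => lt_trans (encode_lt_of_bounded hbXY hv) hEw
  have hmapZ : eZ.map (· % 2 ^ w) = eZ := by
    rw [List.map_congr_left (fun v hv => Nat.mod_eq_of_lt (heZw v hv)), List.map_id']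
  have hseg := readSeg_operands hhX (by rw [← h17]; exact hhY) hX (by rw [← h17]; exact hY)
  have hnn : n ≤ n * n := Nat.le_mul_self n
  -- block 1: the query length
  obtain ⟨st₁, hex₁, S₁, rfl, h20, h21, hS₁⟩ : ∃ st₁, Exec w O
      (block [(.mul, .dir 20, .dir 2, .dir 2), (.add, .dir 21, .dir 20, .dir 20),
        (.add, .dir 21, .dir 21, .imm 2)]) ⟨merge S H, qs⟩ st₁ 3 ∧
      ∃ S₁, st₁ = ⟨merge S₁ H, qs⟩ ∧ S₁ 20 = n * n ∧ S₁ 21 = 2 * (n * n) + 2 ∧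
        ∀ r, r ≠ 20 → r ≠ 21 → S₁ r = S r := by
    refine Exec.block_of_fwd _ _ fun R hR => ?_
    have htmp := execOps_cons_fwd hR; clear hR; obtain ⟨v1, hv1, hR⟩ := htmp
    simp -failIfUnchanged (disch := omega) only [Operand.write, Operand.read, merge_apply_of_lt,
      merge_apply_of_le, Function.update_self, Function.update_of_ne, update_merge_of_lt,
      update_merge_of_le, Nat.add_zero, BinOp.eval_mod, BinOp.eval_eq, BinOp.eval_band,
      BinOp.eval_shr, BinOp.eval_div, BinOp.eval_lt, BinOp.eval_add_of_lt, BinOp.eval_sub_of_le,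
      BinOp.eval_mul_of_lt, h2] at hv1 hR; subst hv1
    have htmp := execOps_cons_fwd hR; clear hR; obtain ⟨v2, hv2, hR⟩ := htmp
    simp -failIfUnchanged (disch := omega) only [Operand.write, Operand.read, merge_apply_of_lt,
      merge_apply_of_le, Function.update_self, Function.update_of_ne, update_merge_of_lt,
      update_merge_of_le, Nat.add_zero, BinOp.eval_mod, BinOp.eval_eq, BinOp.eval_band,
      BinOp.eval_shr, BinOp.eval_div, BinOp.eval_lt, BinOp.eval_add_of_lt, BinOp.eval_sub_of_le,
      BinOp.eval_mul_of_lt, h2] at hv2 hR; subst hv2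
    have htmp := execOps_cons_fwd hR; clear hR; obtain ⟨v3, hv3, hR⟩ := htmp
    simp -failIfUnchanged (disch := omega) only [Operand.write, Operand.read, merge_apply_of_lt,
      merge_apply_of_le, Function.update_self, Function.update_of_ne, update_merge_of_lt,
      update_merge_of_le, Nat.add_zero, BinOp.eval_mod, BinOp.eval_eq, BinOp.eval_band,
      BinOp.eval_shr, BinOp.eval_div, BinOp.eval_lt, BinOp.eval_add_of_lt, BinOp.eval_sub_of_le,
      BinOp.eval_mul_of_lt, h2] at hv3 hR; subst hv3
    simp only [execOps_nil] at hR; subst hR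
    exact ⟨_, rfl, by simp, by simp; ring, fun r h20' h21' => by
      rw [Function.update_of_ne h21', Function.update_of_ne h21', Function.update_of_ne h20']⟩
  have h16₁ : S₁ 16 = S 16 := hS₁ 16 (by omega) (by omega)
  have h9₁ : S₁ 9 = S 9 := hS₁ 9 (by omega) (by omega)
  -- the query
  have hexQ := Exec.query_dir (w := w) (O := O) (qa := 16) (ql := 21) (aa := 9) (by omega) (by omega)
    (by omega) (S := S₁) (by rw [h16₁]; exact h16) (by rw [h9₁]; omega) H qs
  rw [h16₁, h21, h9₁, hseg, hans, hmapZ] at hexQ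
  set H₁ := segWrite H (S 9) eZ with hH₁
  have hH₁lo : ∀ a, a < S 9 → H₁ a = H a := fun a ha => by
    rw [hH₁]; unfold segWrite; rw [if_neg (by omega), if_neg (by omega)]
  have hH₁hi : ∀ a, S 9 + n * n + 2 ≤ a → H₁ a = H a := fun a ha => by
    rw [hH₁]; unfold segWrite; rw [if_neg (by omega), if_neg (by rw [heZlen]; omega)]
  have hH₁ans : ∀ t (ht : t < n * n), H₁ (S 9 + 2 + t) = eZ[t + 1]'(by rw [heZlen]; omega) := by
    intro t ht
    rw [hH₁]; unfold segWrite
    rw [if_neg (by omega), if_pos ⟨by omega, by rw [heZlen]; omega⟩,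
      List.getD_eq_getElem _ _ (by rw [heZlen]; omega)]
    congr 1; omega
  -- block 2: the copy registers
  obtain ⟨st₂, hex₂, S₂, rfl, h12, h13, h14, hS₂⟩ : ∃ st₂, Exec w O
      (block [(.add, .dir 12, .dir 20, .imm 0), (.add, .dir 13, .dir 9, .imm 2),
        (.add, .dir 14, .dir 16, .imm 1)]) ⟨merge S₁ H₁, qs ++ [encodeMatrixWithTop X ++
          encodeMatrixWithTop Y]⟩ st₂ 3 ∧
      ∃ S₂, st₂ = ⟨merge S₂ H₁, qs ++ [encodeMatrixWithTop X ++ encodeMatrixWithTop Y]⟩ ∧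
        S₂ 12 = n * n ∧ S₂ 13 = S 9 + 2 ∧ S₂ 14 = S 16 + 1 ∧
        ∀ r, r ≠ 12 → r ≠ 13 → r ≠ 14 → S₂ r = S₁ r := by
    refine Exec.block_of_fwd _ _ fun R hR => ?_
    have htmp := execOps_cons_fwd hR; clear hR; obtain ⟨v1, hv1, hR⟩ := htmp
    simp -failIfUnchanged (disch := omega) only [Operand.write, Operand.read, merge_apply_of_lt,
      merge_apply_of_le, Function.update_self, Function.update_of_ne, update_merge_of_lt,
      update_merge_of_le, Nat.add_zero, BinOp.eval_mod, BinOp.eval_eq, BinOp.eval_band,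
      BinOp.eval_shr, BinOp.eval_div, BinOp.eval_lt, BinOp.eval_add_of_lt, BinOp.eval_sub_of_le,
      BinOp.eval_mul_of_lt, h20, h9₁, h16₁] at hv1 hR; subst hv1
    have htmp := execOps_cons_fwd hR; clear hR; obtain ⟨v2, hv2, hR⟩ := htmp
    simp -failIfUnchanged (disch := omega) only [Operand.write, Operand.read, merge_apply_of_lt,
      merge_apply_of_le, Function.update_self, Function.update_of_ne, update_merge_of_lt,
      update_merge_of_le, Nat.add_zero, BinOp.eval_mod, BinOp.eval_eq, BinOp.eval_band,
      BinOp.eval_shr, BinOp.eval_div, BinOp.eval_lt, BinOp.eval_add_of_lt, BinOp.eval_sub_of_le,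
      BinOp.eval_mul_of_lt, h20, h9₁, h16₁] at hv2 hR; subst hv2
    have htmp := execOps_cons_fwd hR; clear hR; obtain ⟨v3, hv3, hR⟩ := htmp
    simp -failIfUnchanged (disch := omega) only [Operand.write, Operand.read, merge_apply_of_lt,
      merge_apply_of_le, Function.update_self, Function.update_of_ne, update_merge_of_lt,
      update_merge_of_le, Nat.add_zero, BinOp.eval_mod, BinOp.eval_eq, BinOp.eval_band,
      BinOp.eval_shr, BinOp.eval_div, BinOp.eval_lt, BinOp.eval_add_of_lt, BinOp.eval_sub_of_le,
      BinOp.eval_mul_of_lt, h20, h9₁, h16₁] at hv3 hR; subst hv3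
    simp only [execOps_nil] at hR; subst hR
    exact ⟨_, rfl, by simp, by simp, by simp, fun r h12' h13' h14' => by
      rw [Function.update_of_ne h14', Function.update_of_ne h13', Function.update_of_ne h12']⟩
  -- the copy
  have hval : ∀ i, i < n * n → H₁ (S 9 + 2 + i) < 2 ^ w := fun i hi => by
    rw [hH₁ans i hi]; exact heZw _ (List.getElem_mem _)
  obtain ⟨S₃, H₃, hex₃, hS₃, -, hdst, hoth⟩ := copyUp_spec (w := w) (O := O) h12 h13 h14
    (by omega) (by omega) (Or.inr (by omega)) hval (by omega) (by omega)
    (qs ++ [encodeMatrixWithTop X ++ encodeMatrixWithTop Y])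
  -- block 3: advance the free pointer
  have h9₃ : S₃ 9 = S 9 := by
    rw [hS₃ 9 (by omega) (by omega) (by omega), hS₂ 9 (by omega) (by omega) (by omega), h9₁]
  have h20₃ : S₃ 20 = n * n := by
    rw [hS₃ 20 (by omega) (by omega) (by omega), hS₂ 20 (by omega) (by omega) (by omega), h20]
  obtain ⟨st₄, hex₄, S₄, rfl, h9₄, hS₄⟩ : ∃ st₄, Exec w O
      (block [(.add, .dir 9, .dir 9, .dir 20), (.add, .dir 9, .dir 9, .imm 2)])
      ⟨merge S₃ H₃, qs ++ [encodeMatrixWithTop X ++ encodeMatrixWithTop Y]⟩ st₄ 2 ∧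
      ∃ S₄, st₄ = ⟨merge S₄ H₃, qs ++ [encodeMatrixWithTop X ++ encodeMatrixWithTop Y]⟩ ∧
        S₄ 9 = S 9 + (n * n + 2) ∧ ∀ r, r ≠ 9 → S₄ r = S₃ r := by
    refine Exec.block_of_fwd _ _ fun R hR => ?_
    have htmp := execOps_cons_fwd hR; clear hR; obtain ⟨v1, hv1, hR⟩ := htmp
    simp -failIfUnchanged (disch := omega) only [Operand.write, Operand.read, merge_apply_of_lt,
      merge_apply_of_le, Function.update_self, Function.update_of_ne, update_merge_of_lt,
      update_merge_of_le, Nat.add_zero, BinOp.eval_mod, BinOp.eval_eq, BinOp.eval_band,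
      BinOp.eval_shr, BinOp.eval_div, BinOp.eval_lt, BinOp.eval_add_of_lt, BinOp.eval_sub_of_le,
      BinOp.eval_mul_of_lt, h9₃, h20₃] at hv1 hR; subst hv1
    have htmp := execOps_cons_fwd hR; clear hR; obtain ⟨v2, hv2, hR⟩ := htmp
    simp -failIfUnchanged (disch := omega) only [Operand.write, Operand.read, merge_apply_of_lt,
      merge_apply_of_le, Function.update_self, Function.update_of_ne, update_merge_of_lt,
      update_merge_of_le, Nat.add_zero, BinOp.eval_mod, BinOp.eval_eq, BinOp.eval_band,
      BinOp.eval_shr, BinOp.eval_div, BinOp.eval_lt, BinOp.eval_add_of_lt, BinOp.eval_sub_of_le,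
      BinOp.eval_mul_of_lt, h9₃, h20₃] at hv2 hR; subst hv2
    simp only [execOps_nil] at hR; subst hR
    exact ⟨_, rfl, by simp; omega, fun r h9' => by
      rw [Function.update_of_ne h9', Function.update_of_ne h9']⟩
  -- assemble
  refine ⟨S₄, H₃, [y], ?_, ?_, h9₄, ?_, ?_, ?_, by simp, fun y' hy' => ?_, fun y' hy' => ?_⟩
  · have := hex₁.execLE.seqs_cons (hexQ.execLE.seqs_cons (hex₂.execLE.seqs_cons
      (hex₃.execLE.seqs_cons (ExecLE.seqs_one hex₄.execLE))))
    rw [List.map_singleton, hency]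
    exact this.mono (by omega)
  · intro r hr hr9
    rw [hS₄ r hr9, hS₃ r (by omega) (by omega) (by omega), hS₂ r (by omega) (by omega) (by omega),
      hS₁ r (by omega) (by omega)]
  · intro i j
    have hij : (i : ℕ) * n + j < n * n := NegTriToAPSP.mul_add_lt_mul i.isLt j.isLt
    rw [hdst _ hij, hH₁ans _ hij, NegTriToAPSP.getElem_encodeMatrixWithTop_succ _ _ hij]
    congr <;> ext <;> simp [NegTriToAPSP.div_of_mul_add j.isLt, mul_add_mod_eq j.isLt]
  · intro a ha hout
    rw [hoth a (by omega), hH₁lo a ha]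
  · intro a ha
    rw [h9₄] at ha
    rw [hoth a (Or.inr (by omega)), hH₁hi a (by omega), hz a (by omega)]
  · rw [List.mem_singleton.1 hy']; rfl
  · rw [List.mem_singleton.1 hy', hency, List.length_append, encodeMatrixWithTop_length,
      encodeMatrixWithTop_length, sq]; omega

end psMP

/-! ## Budgets: the logarithmic number of product steps -/

/-- `2 ^ size n ≤ 2 n + 1`. [folklore] -/
theorem two_pow_size_le (n : ℕ) : 2 ^ Nat.size n ≤ 2 * n + 1 := by
  rcases Nat.eq_zero_or_pos n with rfl | hn
  · simp
  · have hs : 0 < Nat.size n := Nat.size_pos.2 hn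
    have : 2 ^ (Nat.size n - 1) ≤ n := Nat.lt_size.1 (by omega)
    calc 2 ^ Nat.size n = 2 ^ (Nat.size n - 1) * 2 := by rw [← pow_succ]; congr 1; omega
      _ ≤ 2 * n + 1 := by omega

/-- The number of bits of `n` is `O(n^η)` for every `η > 0`. [folklore] -/
theorem size_le_rpow {η : ℝ} (hη : 0 < η) :
    ∃ K : ℝ, 0 ≤ K ∧ ∀ n : ℕ, (Nat.size n : ℝ) ≤ K * (n : ℝ) ^ η := by
  have hlog2 : 0 < Real.log 2 := Real.log_pos (by norm_num)
  refine ⟨(3 : ℝ) ^ η / (η * Real.log 2), by positivity, fun n => ?_⟩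
  rcases Nat.eq_zero_or_pos n with rfl | hn
  · simp [Real.zero_rpow hη.ne']
  · have hn' : (0 : ℝ) < n := by exact_mod_cast hn
    have h1 : (2 : ℝ) ^ Nat.size n ≤ 3 * n := by
      have := two_pow_size_le n
      have h' : ((2 ^ Nat.size n : ℕ) : ℝ) ≤ ((2 * n + 1 : ℕ) : ℝ) := by exact_mod_cast this
      push_cast at h'
      have : (1 : ℝ) ≤ n := by exact_mod_cast hn
      linarith
    have h2 : (Nat.size n : ℝ) * Real.log 2 ≤ Real.log (3 * n) := by
      rw [← Real.log_pow]
      exact Real.log_le_log (by positivity) h1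
    have h3 : Real.log (3 * n) ≤ (3 * n) ^ η / η := Real.log_le_rpow_div (by positivity) hη
    have h4 : ((3 : ℝ) * n) ^ η = 3 ^ η * (n : ℝ) ^ η := Real.mul_rpow (by norm_num) hn'.le
    rw [h4] at h3
    have h5 : (Nat.size n : ℝ) ≤ (3 ^ η * (n : ℝ) ^ η / η) / Real.log 2 := by
      rw [le_div_iff₀ hlog2]; linarith
    calc (Nat.size n : ℝ) ≤ (3 ^ η * (n : ℝ) ^ η / η) / Real.log 2 := h5
      _ = 3 ^ η / (η * Real.log 2) * (n : ℝ) ^ η := by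
        field_simp

/-- **The budgets of the distance-product oracle step**: with `T n = 6 n² + 10`, one query of
size `n` and length `2 n² + 2` per call, the driver runs in `O(n² log n)` time, its oracle
ledger is `O(log n · (n³)^{1-ε})` and its total query length `O(n² log n)` — all
`≤ C (n³)^{1-δ} + C` for `δ = min (ε/2) (1/6)`. [folklore] -/
theorem psMP_budget (ε : ℝ) (hε : 0 < ε) : ∃ δ : ℝ, 0 < δ ∧ ∃ C : ℝ, ∀ n : ℕ,
    ((Tdrv (fun n => 6 * (n * n) + 10) n + 1 : ℕ) : ℝ) ≤ C * ((n : ℝ) ^ (3 : ℝ)) ^ (1 - δ) + C ∧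
    ((2 * Nat.size n * 1 : ℕ) : ℝ) * (((n : ℕ) : ℝ) ^ (3 : ℝ)) ^ (1 - ε) ≤
      C * ((n : ℝ) ^ (3 : ℝ)) ^ (1 - δ) + C ∧
    ((2 * Nat.size n * 1 * (2 * (n * n) + 2) : ℕ) : ℝ) ≤ C * ((n : ℝ) ^ (3 : ℝ)) ^ (1 - δ) + C := by
  obtain ⟨K₁, hK₁, hN₁⟩ := size_le_rpow (by norm_num : (0 : ℝ) < 1 / 2)
  obtain ⟨K₂, hK₂, hN₂⟩ := size_le_rpow (by positivity : (0 : ℝ) < 3 * ε / 2)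
  refine ⟨min (ε / 2) (1 / 6), lt_min (by linarith) (by norm_num),
    38 + 56 * K₁ + 46 + 2 * K₂ + 8 * K₁, fun n => ?_⟩
  set δ := min (ε / 2) (1 / 6) with hδ
  have hδ1 : δ ≤ ε / 2 := min_le_left _ _
  have hδ2 : δ ≤ 1 / 6 := min_le_right _ _
  set B := ((n : ℝ) ^ (3 : ℝ)) ^ (1 - δ) with hBdef
  have hB0 : 0 ≤ B := Real.rpow_nonneg (Real.rpow_nonneg (Nat.cast_nonneg _) _) _
  have hT : ((Tdrv (fun n => 6 * (n * n) + 10) n + 1 : ℕ) : ℝ) =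
      38 * ((n : ℝ) * n) + 46 + (Nat.size n : ℝ) * (18 * ((n : ℝ) * n) + 38) := by
    simp only [Tdrv]; push_cast; ring
  rcases Nat.eq_zero_or_pos n with rfl | hn
  · have hs : Nat.size 0 = 0 := Nat.size_zero
    rw [hT, hs]
    simp only [Nat.cast_zero, mul_zero, zero_mul, zero_add, add_zero]
    refine ⟨?_, ?_, ?_⟩ <;> nlinarith [mul_nonneg hK₁ hB0, mul_nonneg hK₂ hB0]
  · have hn1 : (1 : ℝ) ≤ n := by exact_mod_cast hn
    have hn0 : (0 : ℝ) < n := by positivity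
    have hB : B = (n : ℝ) ^ (3 * (1 - δ)) := by
      rw [hBdef, ← Real.rpow_mul hn0.le]
    have h52 : (n : ℝ) ^ (5 / 2 : ℝ) ≤ B :=
      hB ▸ Real.rpow_le_rpow_of_exponent_le hn1 (by linarith)
    have h3e : (n : ℝ) ^ (3 - 3 * ε / 2) ≤ B :=
      hB ▸ Real.rpow_le_rpow_of_exponent_le hn1 (by linarith)
    have hn2 : (n : ℝ) * n = (n : ℝ) ^ (2 : ℝ) := by rw [Real.rpow_two, sq]
    have hsq : (n : ℝ) ^ (2 : ℝ) * (n : ℝ) ^ (1 / 2 : ℝ) = (n : ℝ) ^ (5 / 2 : ℝ) := by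
      rw [← Real.rpow_add hn0]; norm_num
    have hsq' : (n : ℝ) * n ≤ (n : ℝ) ^ (5 / 2 : ℝ) := by
      rw [hn2]; exact Real.rpow_le_rpow_of_exponent_le hn1 (by norm_num)
    have hcube : (n : ℝ) ^ (3 * ε / 2) * ((n : ℝ) ^ (3 : ℝ)) ^ (1 - ε) = (n : ℝ) ^ (3 - 3 * ε / 2) := by
      rw [← Real.rpow_mul hn0.le, ← Real.rpow_add hn0]; ring_nf
    have hN1 := hN₁ n
    have hN2 := hN₂ n
    have hsz0 : (0 : ℝ) ≤ Nat.size n := Nat.cast_nonneg _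
    have hr0 : (0 : ℝ) ≤ (n : ℝ) ^ (1 / 2 : ℝ) := Real.rpow_nonneg hn0.le _
    -- the key products
    have hP1 : (Nat.size n : ℝ) * ((n : ℝ) * n) ≤ K₁ * (n : ℝ) ^ (5 / 2 : ℝ) := by
      calc (Nat.size n : ℝ) * ((n : ℝ) * n) ≤ K₁ * (n : ℝ) ^ (1 / 2 : ℝ) * ((n : ℝ) * n) :=
            mul_le_mul_of_nonneg_right hN1 (by positivity)
        _ = K₁ * (n : ℝ) ^ (5 / 2 : ℝ) := by rw [hn2, mul_assoc, mul_comm (_ ^ (1 / 2 : ℝ)), hsq]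
    have hP0 : (Nat.size n : ℝ) ≤ K₁ * (n : ℝ) ^ (5 / 2 : ℝ) :=
      le_trans hN1 (mul_le_mul_of_nonneg_left
        (Real.rpow_le_rpow_of_exponent_le hn1 (by norm_num)) hK₁)
    have hP2 : (Nat.size n : ℝ) * ((n : ℝ) ^ (3 : ℝ)) ^ (1 - ε) ≤ K₂ * (n : ℝ) ^ (3 - 3 * ε / 2) := by
      calc (Nat.size n : ℝ) * ((n : ℝ) ^ (3 : ℝ)) ^ (1 - ε)
            ≤ K₂ * (n : ℝ) ^ (3 * ε / 2) * ((n : ℝ) ^ (3 : ℝ)) ^ (1 - ε) :=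
            mul_le_mul_of_nonneg_right hN2 (Real.rpow_nonneg (Real.rpow_nonneg hn0.le _) _)
        _ = K₂ * (n : ℝ) ^ (3 - 3 * ε / 2) := by rw [mul_assoc, hcube]
    have hK1B : K₁ * (n : ℝ) ^ (5 / 2 : ℝ) ≤ K₁ * B := mul_le_mul_of_nonneg_left h52 hK₁
    have hK2B : K₂ * (n : ℝ) ^ (3 - 3 * ε / 2) ≤ K₂ * B := mul_le_mul_of_nonneg_left h3e hK₂
    refine ⟨?_, ?_, ?_⟩
    · rw [hT]
      nlinarith [hP1, hP0, hK1B, hsq', h52, hB0, mul_nonneg hK₂ hB0]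
    · push_cast
      nlinarith [hP2, hK2B, hB0, mul_nonneg hK₁ hB0]
    · push_cast
      nlinarith [hP1, hP0, hK1B, hB0, mul_nonneg hK₂ hB0]

/-! ## APSP `≤₃` distance product -/

/-- **Discharge of `APSP_fgReducible_minPlusProduct`** (Vassilevska Williams–Williams 2018, §2
p. 27:8, after Fischer–Meyer [28]: APSP by `O(log n)` distance products of matrices with entries
`≤ n · nᶜ`): take `c' = c + 1`; the reduction is the square-and-multiply driver with the
distance-product oracle step. [cite: VassilevskaWilliamsWilliams2018, §2 p. 27:8] -/
theorem APSP_fgReducible_minPlusProduct_holds : APSP_fgReducible_minPlusProduct := fun c =>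
  ⟨c + 1, fgReducible_APSP_of_prodSpec (psMP_spec c) (by omega) (by omega)
    (fun n => calc n * n + 2 ≤ (n + 2) ^ 2 := by nlinarith
      _ ≤ (n + 2) ^ (c + 5) := Nat.pow_le_pow_right (by omega) (by omega))
    psMP_budget⟩

end Literature.Computability.FineGrained.APSPPower
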